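import Summits.NavierStokesRegularity.NavierStokesRegularity.Theorems.AdaptedFrequencyAdaptedKernelExistsPrekernelDecay

/-!
# Crux `AdaptedFrequencyConverges` (stmt-NavierStokesRegularity-10493), line
  `cloud-frame-effective-tsai`: DECAY AT SPATIAL INFINITY for STUB `stub_blockSolver`

Helper file (lands `--supports stmt-NavierStokesRegularity-10493`).  Setting: `g` jointly
smooth on the open slab `Ioo ta T × E`, a classical solution of `∂ₜg + b·∇g + νΔg = 0` there
(`‖b‖ ≤ B` on `Ico ta T`), with `H + w = g` a.e. on the slab, where `w ∈ L²(ℝ × E)` and the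
"free part" `H` admits on every compact time interval `[a′, b′] ⊂ (ta, T)` an integrable
majorant `|H(s, ·)| ≤ Φ`.  For a general finite-dimensional inner product space `E`:

* `decay_box_small`: `∫_{(a′, b′] × B(y, r)} |g| → 0` as `‖y − x₀‖ → ∞` (a.e.
  `|g| ≤ Φ + η′ + w²/(4η′)`; the majorant `Φ 1_{[a′, b′]} + w²/(4η′)` is integrable on `ℝ × E`
  and its integrals over `{‖x − x₀‖ ≥ ρ}` tend to `0`);
* `decay_of_majorant`: hence, by Lieberman's local maximum principle in the form of the tree's
  `prekernel_lieberman` and the substitution `prekernel_box_subst`, for every block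
  `[t, Ta] ⊂ (ta, T)` and `δ > 0` there is `ρ₀` with `|g(s, y)| ≤ δ` for `s ∈ [t, Ta]`,
  `‖y − x₀‖ ≥ ρ₀`.

This is the pattern of the tree's `prekernel_box_small` / `prekernel_decay` (files
`…AdaptedKernelExistsPrekernelDecayBox`, `…PrekernelDecay`, there for `H` the backward heat
kernel), with the Gaussian majorant abstracted into the hypothesis `hH`.
-/

noncomputable section

open MeasureTheory Set Filter Topology Metric Function Real
open scoped Laplacian ContDiff
open Literature.Analysis.FluidPDE Literature.Analysis.UnboundedOperators
open Summit.NavierStokesRegularity.NavierStokesRegularity.Theorems.AdaptedKernelExists.NashEntropyLastBlock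

namespace Summit.NavierStokesRegularity.NavierStokesRegularity.Theorems.AdaptedFrequencyConverges.CloudFrameEffectiveTsai

section General

variable {E : Type*} [NormedAddCommGroup E] [InnerProductSpace ℝ E] [FiniteDimensional ℝ E]
  [MeasurableSpace E] [BorelSpace E]

/-- **`L¹`-smallness of far boxes.** Let `g` be jointly smooth on the open slab `Ioo ta T × E`
with `H + w = g` a.e. there, `w ∈ L²(ℝ × E)`, and `|H(s, x)| ≤ Φ(x)` for `s ∈ [a′, b′]`,
`ta < a′ ≤ b′ < T`, `Φ` integrable.  Then for every `η > 0` there is `ρ₀` with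
`∫_{(a′, b′] × B(y, r)} |g| ≤ η` whenever `‖y − x₀‖ ≥ ρ₀`. -/
theorem decay_box_small {ta T a' b' r : ℝ} {x₀ : E} {H : ℝ → E → ℝ} {w : ℝ × E → ℝ}
    {g : ℝ → E → ℝ} {Φ : E → ℝ} (ha' : ta < a') (hab : a' ≤ b') (hb' : b' < T)
    (hw2 : MemLp w 2 volume) (hg : IsSmoothSpaceTimeOn (Ioo ta T) g)
    (hae : ∀ᵐ p : ℝ × E, p ∈ Ioo ta T ×ˢ univ → H p.1 p.2 + w p = g p.1 p.2)
    (hH : ∀ s ∈ Icc a' b', ∀ x, |H s x| ≤ Φ x) (hΦ : Integrable Φ) {η : ℝ} (hη : 0 < η) :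
    ∃ ρ₀ : ℝ, ∀ y, ρ₀ ≤ ‖y - x₀‖ → ∫ p in Ioc a' b' ×ˢ ball y r, |g p.1 p.2| ≤ η := by
  -- the volume of the boxes and the parameter `η′`
  obtain ⟨V, hV⟩ : ∃ V : ℝ, V = volume.real (Ioc a' b') * volume.real (ball (0:E) r) := ⟨_, rfl⟩
  have hV0 : 0 ≤ V := by rw [hV]; exact mul_nonneg measureReal_nonneg measureReal_nonneg
  have hVy : ∀ y : E, volume.real (Ioc a' b' ×ˢ ball y r) = V := fun y => by
    rw [hV]; exact prekernel_volume_box a' b' r y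
  obtain ⟨η', hη'⟩ : ∃ η' : ℝ, η' = η / (3 * (V + 1)) := ⟨_, rfl⟩
  have hη'0 : 0 < η' := by rw [hη']; positivity
  have hη'V : η' * V ≤ η / 3 := by
    rw [hη', div_mul_eq_mul_div, div_le_div_iff₀ (by positivity) (by norm_num)]
    nlinarith
  have hΦ0 : ∀ x, 0 ≤ Φ x := fun x => (abs_nonneg _).trans (hH a' ⟨le_rfl, hab⟩ x)
  -- the integrable majorant
  obtain ⟨Hm, hHm⟩ : ∃ Hm : ℝ × E → ℝ, Hm = fun p =>
      (Icc a' b').indicator (fun _ => (1:ℝ)) p.1 * Φ p.2 + w p ^ 2 / (4 * η') := ⟨_, rfl⟩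
  have hHi : Integrable Hm := by
    rw [hHm]
    refine Integrable.add ?_ ((hw2.integrable_sq).div_const _)
    have h1 : Integrable ((Icc a' b').indicator fun _ => (1:ℝ)) (volume : Measure ℝ) :=
      (integrable_indicator_iff measurableSet_Icc).2 (integrableOn_const measure_Icc_lt_top.ne)
    exact h1.mul_prod hΦ
  have hH0 : ∀ p, 0 ≤ Hm p := fun p => by
    rw [hHm]
    exact add_nonneg (mul_nonneg (Set.indicator_nonneg (fun _ _ => zero_le_one) _) (hΦ0 _))
      (div_nonneg (sq_nonneg _) (by positivity))
  -- the tails of the majorant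
  obtain ⟨S, hS⟩ : ∃ S : ℝ → Set (ℝ × E), S = fun ρ => {p | ρ ≤ ‖p.2 - x₀‖} := ⟨_, rfl⟩
  have hSmem : ∀ ρ (p : ℝ × E), p ∈ S ρ ↔ ρ ≤ ‖p.2 - x₀‖ := fun ρ p => by rw [hS]; rfl
  have hSm : ∀ ρ, MeasurableSet (S ρ) := fun ρ => by
    rw [hS]
    exact (isClosed_le continuous_const (continuous_snd.sub continuous_const).norm).measurableSet
  have hSa : Antitone S := fun ρ₁ ρ₂ h p hp => by
    rw [hSmem] at hp ⊢
    exact h.trans hp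
  have hSe : (⋂ ρ, S ρ) = ∅ := by
    refine eq_empty_of_forall_notMem fun p hp => ?_
    have := (hSmem _ p).1 (mem_iInter.1 hp (‖p.2 - x₀‖ + 1))
    linarith
  have hT : Tendsto (fun ρ => ∫ p in S ρ, Hm p) atTop (𝓝 0) := by
    have := tendsto_setIntegral_of_antitone hSm hSa ⟨0, hHi.integrableOn⟩
    rwa [hSe, Measure.restrict_empty, integral_zero_measure] at this
  obtain ⟨ρ₁, hρ₁⟩ := eventually_atTop.1
    (Tendsto.eventually_le_const (show (0:ℝ) < η / 3 by positivity) hT)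
  refine ⟨ρ₁ + r, fun y hy => ?_⟩
  -- the box at `y`
  have hbox_sub : Ioc a' b' ×ˢ ball y r ⊆ S ρ₁ := by
    rintro ⟨s, x⟩ ⟨-, hx⟩
    rw [hSmem]
    rw [mem_ball, dist_eq_norm] at hx
    have h1 := norm_sub_le_norm_sub_add_norm_sub y x x₀
    rw [← norm_neg (y - x), neg_sub] at h1
    show ρ₁ ≤ ‖x - x₀‖
    linarith
  have hslab : Ioc a' b' ×ˢ ball y r ⊆ Ioo ta T ×ˢ univ :=
    prod_mono (fun s hs => ⟨ha'.trans hs.1, hs.2.trans_lt hb'⟩) (subset_univ _)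
  have hmeas : MeasurableSet (Ioc a' b' ×ˢ ball y r) := measurableSet_Ioc.prod measurableSet_ball
  have hK2 : IsCompact (Icc a' b' ×ˢ closedBall y r) :=
    isCompact_Icc.prod (isCompact_closedBall y r)
  have hIg : IntegrableOn (fun p : ℝ × E => |g p.1 p.2|) (Ioc a' b' ×ˢ ball y r) :=
    prekernel_integrableOn_box ha' hb' hg y
  have hfin : volume (Ioc a' b' ×ˢ ball y r) < ⊤ :=
    (measure_mono (Set.prod_mono Ioc_subset_Icc_self ball_subset_closedBall)).trans_lt
      hK2.measure_lt_top
  have hIH : IntegrableOn (fun p => Hm p + η') (Ioc a' b' ×ˢ ball y r) :=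
    hHi.integrableOn.add (integrableOn_const hfin.ne)
  -- the a.e. bound `|g| ≤ Hm + η′` on the box
  have hae' : ∀ᵐ p ∂(volume.restrict (Ioc a' b' ×ˢ ball y r)), |g p.1 p.2| ≤ Hm p + η' := by
    rw [ae_restrict_iff' hmeas]
    filter_upwards [hae] with p hp hpB
    have h1 := hp (hslab hpB)
    have hs : p.1 ∈ Icc a' b' := Ioc_subset_Icc_self hpB.1
    have hAM : |w p| ≤ η' + w p ^ 2 / (4 * η') := by
      have key : (|w p| - η') * (4 * η') ≤ w p ^ 2 := by
        nlinarith [sq_nonneg (|w p| - 2 * η'), sq_abs (w p)]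
      have := (le_div_iff₀ (show (0:ℝ) < 4 * η' by positivity)).2 key
      linarith
    rw [← h1, hHm]
    simp only [indicator_of_mem hs, one_mul]
    calc |H p.1 p.2 + w p| ≤ |H p.1 p.2| + |w p| := abs_add_le _ _
      _ ≤ Φ p.2 + (η' + w p ^ 2 / (4 * η')) := add_le_add (hH p.1 hs p.2) hAM
      _ = Φ p.2 + w p ^ 2 / (4 * η') + η' := by ring
  -- assembling
  calc ∫ p in Ioc a' b' ×ˢ ball y r, |g p.1 p.2|
      ≤ ∫ p in Ioc a' b' ×ˢ ball y r, (Hm p + η') := integral_mono_ae hIg hIH hae'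
    _ = (∫ p in Ioc a' b' ×ˢ ball y r, Hm p) + η' * V := by
        rw [integral_add hHi.integrableOn (integrableOn_const hfin.ne), setIntegral_const, hVy,
          smul_eq_mul, mul_comm V]
    _ ≤ (∫ p in S ρ₁, Hm p) + η / 3 :=
        add_le_add (setIntegral_mono_set hHi.integrableOn (Eventually.of_forall fun p => hH0 p)
          hbox_sub.eventuallyLE) hη'V
    _ ≤ η / 3 + η / 3 := add_le_add (hρ₁ ρ₁ le_rfl) le_rfl
    _ ≤ η := by linarith

/-- **Uniform decay at spatial infinity on a block.** Let `g` be a smooth classical solution of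
`∂ₜg + b·∇g + νΔg = 0` on the open slab `Ioo ta T × E` (`‖b‖ ≤ B` on `Ico ta T`), equal a.e. on
the slab to `H + w` with `w ∈ L²(ℝ × E)` and `H` admitting an integrable majorant on every
compact time interval inside `(ta, T)`.  Then for every `t ∈ (ta, Ta)`, `Ta < T`, and `δ > 0`
there is `ρ₀` with `|g(s, y)| ≤ δ` for all `s ∈ [t, Ta]`, `‖y − x₀‖ ≥ ρ₀` (Lieberman's local
maximum principle `prekernel_lieberman` with the geometry of `prekernel_decay`, and
`decay_box_small`). -/
theorem decay_of_majorant {ν ta Ta T B t : ℝ} {b : ℝ → E → E} {x₀ : E} {H : ℝ → E → ℝ}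
    {w : ℝ × E → ℝ} {g : ℝ → E → ℝ} (hν : 0 < ν) (hTa : Ta < T) (ht : t ∈ Ioo ta Ta)
    (hb : IsSmoothSpaceTimeOn (Ico ta T) b) (hB : ∀ s ∈ Ico ta T, ∀ x, ‖b s x‖ ≤ B)
    (hw2 : MemLp w 2 volume) (hg : IsSmoothSpaceTimeOn (Ioo ta T) g)
    (hae : ∀ᵐ p : ℝ × E, p ∈ Ioo ta T ×ˢ univ → H p.1 p.2 + w p = g p.1 p.2)
    (hH : ∀ a' b' : ℝ, ta < a' → b' < T →
      ∃ Φ : E → ℝ, Integrable Φ ∧ ∀ s ∈ Icc a' b', ∀ x, |H s x| ≤ Φ x)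
    (heq : ∀ s ∈ Ioo ta T, ∀ x,
      deriv (fun r => g r x) s + fderiv ℝ (g s) x (b s x) + ν * (Δ (g s)) x = 0)
    {δ : ℝ} (hδ : 0 < δ) :
    ∃ ρ₀ : ℝ, ∀ s ∈ Icc t Ta, ∀ y, ρ₀ ≤ ‖y - x₀‖ → |g s y| ≤ δ := by
  -- the geometry
  obtain ⟨Ts, hTs⟩ : ∃ Ts : ℝ, Ts = (Ta + T) / 2 := ⟨_, rfl⟩
  obtain ⟨a', ha'⟩ : ∃ a' : ℝ, a' = (ta + t) / 2 := ⟨_, rfl⟩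
  obtain ⟨b', hb'⟩ : ∃ b' : ℝ, b' = (Ta + Ts) / 2 := ⟨_, rfl⟩
  have hTaTs : Ta < Ts := by rw [hTs]; linarith
  have hTsT : Ts < T := by rw [hTs]; linarith
  have hta' : ta < a' := by rw [ha']; linarith [ht.1]
  have ha't : a' < t := by rw [ha']; linarith [ht.1]
  have hab : a' ≤ b' := by rw [ha', hb']; linarith [ht.2]
  have hb's : b' < Ts := by rw [hb']; linarith
  have hb'T : b' < T := hb's.trans hTsT
  have hm₁ : 0 < ν * (t - ta) := mul_pos hν (by linarith [ht.1])
  have hm₂ : 0 < ν * (Ts - Ta) / 7 := by positivity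
  obtain ⟨R, hRdef⟩ : ∃ R : ℝ, R = min 1 (min (ν * (t - ta)) (ν * (Ts - Ta) / 7)) := ⟨_, rfl⟩
  have hR : 0 < R := by rw [hRdef]; exact lt_min one_pos (lt_min hm₁ hm₂)
  have hR1 : R ≤ 1 := by rw [hRdef]; exact min_le_left _ _
  have hRa : R ≤ ν * (t - ta) := by rw [hRdef]; exact (min_le_right _ _).trans (min_le_left _ _)
  have hRb : R ≤ ν * (Ts - Ta) / 7 := by
    rw [hRdef]; exact (min_le_right _ _).trans (min_le_right _ _)
  have hRR : R ^ 2 ≤ R := by nlinarith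
  have haR : 2 * ν * a' + R ^ 2 ≤ 2 * ν * t := by rw [ha']; nlinarith
  have hbR : 2 * ν * Ta + 7 * R ^ 2 ≤ 2 * ν * b' := by rw [hb']; nlinarith
  obtain ⟨C, hC, hL⟩ := prekernel_lieberman hν ht hTaTs hTsT hb hB hg heq hR hR1 hta' haR hbR hb's
  -- the smallness of the box integrals
  have hη : 0 < δ * R ^ (Module.finrank ℝ E + 2) / (2 * C * ν) := by positivity
  obtain ⟨Φ, hΦ, hHΦ⟩ := hH a' b' hta' hb'T
  obtain ⟨ρ₀, hρ₀⟩ := decay_box_small (r := 2 * R) (x₀ := x₀) hta' hab hb'T hw2 hg hae hHΦ hΦ hη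
  refine ⟨ρ₀, fun s hs y hy => ?_⟩
  have h1 := hL s hs y (δ / (2 * C * R)) (by positivity)
  rw [prekernel_box_subst hν hta' hab hb'T hg y] at h1
  have h2 := hρ₀ y hy
  have hRn : 0 < R ^ (Module.finrank ℝ E + 2) := by positivity
  calc |g s y| ≤ C * ((R ^ (Module.finrank ℝ E + 2))⁻¹ *
        (ν * ∫ p in Ioc a' b' ×ˢ ball y (2 * R), |g p.1 p.2|) + δ / (2 * C * R) * R) := h1
    _ ≤ C * ((R ^ (Module.finrank ℝ E + 2))⁻¹ *
        (ν * (δ * R ^ (Module.finrank ℝ E + 2) / (2 * C * ν))) + δ / (2 * C * R) * R) := by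
        gcongr
    _ = δ := by
        field_simp
        ring

end General

/-! ### Registered sub-goal (dimension three) -/

/-- **Registered sub-goal `stub_blockSolver_decay`** (the `ℝ³` form of `decay_of_majorant`,
sub-goal of STUB `stub_blockSolver`): a smooth classical solution of `∂ₜg + b·∇g + νΔg = 0` on the
open slab, equal a.e. to `H + w` with `w ∈ L²` and `H` locally majorised by integrable functions
of `x`, tends to `0` at spatial infinity uniformly on every block `[t, Ta] ⊂ (ta, T)`. -/
theorem stub_blockSolver_decay :
    ∀ (ν ta Ta T B t δ : ℝ) (b : ℝ → (EuclideanSpace ℝ (Fin 3)) → (EuclideanSpace ℝ (Fin 3))) (x₀ : (EuclideanSpace ℝ (Fin 3))) (H : ℝ → (EuclideanSpace ℝ (Fin 3)) → ℝ) (w : ℝ × (EuclideanSpace ℝ (Fin 3)) → ℝ) (g : ℝ → (EuclideanSpace ℝ (Fin 3)) → ℝ), 0 < ν → Ta < T → t ∈ Ioo ta Ta → IsSmoothSpaceTimeOn (Ico ta T) b → (∀ s ∈ Ico ta T, ∀ x, ‖b s x‖ ≤ B) → MemLp w 2 volume → IsSmoothSpaceTimeOn (Ioo ta T) g → (∀ᵐ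 p : ℝ × (EuclideanSpace ℝ (Fin 3)), p ∈ Ioo ta T ×ˢ univ → H p.1 p.2 + w p = g p.1 p.2) → (∀ a' b' : ℝ, ta < a' → b' < T → ∃ Φ : (EuclideanSpace ℝ (Fin 3)) → ℝ, Integrable Φ ∧ ∀ s ∈ Icc a' b', ∀ x, |H s x| ≤ Φ x) → (∀ s ∈ Ioo ta T, ∀ x, deriv (fun r => g r x) s + fderiv ℝ (g s) x (b s x) + ν * Laplacian.laplacian (g s) x = 0) → 0 < δ → ∃ ρ₀ : ℝ, ∀ s ∈ Icc t Ta, ∀ y, ρ₀ ≤ ‖y - x₀‖ → |g s y| ≤ δ :=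
  fun _ _ _ _ _ _ _ _ _ _ _ _ hν hTa ht hb hB hw2 hg hae hH heq hδ =>
    decay_of_majorant hν hTa ht hb hB hw2 hg hae hH heq hδ

end Summit.NavierStokesRegularity.NavierStokesRegularity.Theorems.AdaptedFrequencyConverges.CloudFrameEffectiveTsai

end
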